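import Summits.PneNP.PneNP.Theorems.ReslinSizeFromWidthRandomThreeCnfResLinRank
import Literature.Computability.MetaComplexity.ResLinSpace
import Literature.Computability.MetaComplexity.ResLinSpaceWidth
import Literature.Computability.MetaComplexity.ResLinSpaceUpperBound

/-!
# PneNP / ReslinSizeFromWidth — the SPACE rail: Res(⊕) clause space from rank, random 3-CNF

Route `PneNP/ReslinSizeFromWidth` (supports the crux stmt-PneNP-18932 `ResLinSizeFromWidth`, whose
hypothesis is a linear RANK lower bound for every Res(⊕) refutation). The crux asks for SIZE from
rank and is open beyond the quadratic truncation (`ReslinSizeFromWidthQuadratic.lean`); this file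
records what the same rank hypothesis gives for the other classical resource, CLAUSE SPACE
(configuration-style Res(⊕) refutations with download / erase / one-rule inference,
`Literature.Computability.MetaComplexity.IsResLinSpaceRefutation`, `resLinClauseSpace` — the
Esteban–Torán / ABRW measure one proof system up), by the space–width relation of
Gryaznov–Ovcharov–Riazanov [ACM ToCT 2024, Thm 6], PROVED in the tree
(`Literature.Computability.MetaComplexity.le_resLinClauseSpace_of_forall_lt_resLinWidth`, semantic
weakening treated directly):

* `resLinClauseSpace_of_rank` — the route-vocabulary form of GOR Thm 6: a width-`≤ t` CNF all of
  whose Res(⊕) refutations satisfy `k < resLinWidth π` (`t ≤ k`) has only configuration-style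
  refutations of clause space `≥ k + 2 − t`; `resLinClauseSpace_of_coverExpander` — with the gen-1
  rung (stmt-PneNP-18934, `widthFromVertexExpansion_proof`): `(r, 1+γ)`-cover expansion of the
  clause scopes forces clause space `≥ ⌊γr/2⌋ + 2 − t`;
* `randomThreeCnf_resLinClauseSpace_linear` — for every integer density `c ≥ 6` there is `δ > 0`
  with `Pr_{φ ∼ F₃(n, cn)}[φ unsat ∧ every configuration-style Res(⊕) refutation of φ keeps more
  than δ·n linear clauses in memory at some moment] → 1` (from `randomThreeCnf_resLinRank_linear`,
  gen-1 rung of this route, `δ = δ₀/2`); and the matching UPPER bound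
  `minResLinClauseSpace_le_of_mem_support_randomKCNF` — every unsatisfiable formula in the support of
  `F_k(n, m)` has Res(⊕) clause space `≤ n + 2` (Esteban–Torán one system up,
  `ResLinSpaceUpperBound.lean`), so the random-3-CNF clause space is `Θ(n)` whp.

Honest status: a REPRODUCTION rung (GOR 2024 Thm 6 is in print; the random-3-CNF consequence is in
print only implicitly, via GOR Cor. 1 `Space ≥ Deg − r − 1` and the Alekhnovich–Razborov PC-degree
bound for random k-CNF); new here = kernel-checked, stated for Itsykson–Sokolov's system with
semantic weakening over plain CNFs, via the tree's direct rank bound (no polynomial calculus).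
Nothing about SIZE or DEPTH of dag-like Res(⊕) is claimed (that is the open crux stmt-PneNP-18932).

References: S. Gryaznov, S. Ovcharov, A. Riazanov, ACM ToCT 16(3) (2024), Thm 6, Cor 1
[GryaznovOvcharovRiazanov2024]; J. L. Esteban, J. Torán, Inform. Comput. 171 (2001)
[EstebanToran2001]; V. Chvátal, E. Szemerédi, J. ACM 35 (1988) [ChvatalSzemeredi1988];
K. Efremenko, M. Garlík, D. Itsykson, STOC 2024, §1.2 [EfremenkoGarlikItsykson2024].
-/

namespace Summit.PneNP.PneNP.Theorems

-- `Summit.PneNP.PneNP` repeats a path component by design (summit = sub-problem); silence the linter.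
set_option linter.dupNamespace false

open Filter Literature.Computability.Complexity Literature.Computability.MetaComplexity
open scoped Topology

/-- **Clause space from rank (GOR 2024 Thm 6, route vocabulary).** If `φ` has clause width `≤ t`,
`t ≤ k`, and EVERY dag-like Res(⊕) refutation of `φ` (semantic weakening, `IsResLinRefutation`) has
a line of rank `> k` (`k < resLinWidth π`), then every configuration-style Res(⊕) refutation of `φ`
has clause space `≥ k + 2 − t`. [GryaznovOvcharovRiazanov2024, Thm 6; proved in
`Literature.Computability.MetaComplexity.ResLinSpaceWidth`] -/
theorem resLinClauseSpace_of_rank {φ : CNF ℕ} {t k : ℕ} (hφ : φ.IsWidthLE t) (htk : t ≤ k)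
    (hrank : ∀ π : List ResLinLine, IsResLinRefutation φ π → k < resLinWidth π)
    {ϖ : List (Finset LinClause)} (hϖ : IsResLinSpaceRefutation φ ϖ) :
    k + 2 - t ≤ resLinClauseSpace ϖ :=
  le_resLinClauseSpace_of_forall_lt_resLinWidth hφ htk hrank hϖ

/-- **Clause space from cover expansion.** If `φ` has clause width `≤ t` and its clause scopes
form an `(r, 1+γ)`-cover expander (`γ > 0`, `r ≥ 2`) with `t ≤ ⌊γr/2⌋`, then every
configuration-style Res(⊕) refutation of `φ` has clause space `≥ ⌊γr/2⌋ + 2 − t` (gen-1 rung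
`widthFromVertexExpansion_proof`: every refutation has a line of rank `> γr/2`, then
`resLinClauseSpace_of_rank`). [Jukna2012, Thm 18.19 (resolution analogue);
GryaznovOvcharovRiazanov2024, Thm 6] -/
theorem resLinClauseSpace_of_coverExpander {φ : CNF ℕ} {t : ℕ} (hφ : φ.IsWidthLE t) {γ r : ℝ}
    (hγ : 0 < γ) (hr : 2 ≤ r) (hexp : IsCoverExpander (cnfScopes φ) r (1 + γ))
    (ht : t ≤ ⌊γ * r / 2⌋₊) {ϖ : List (Finset LinClause)} (hϖ : IsResLinSpaceRefutation φ ϖ) :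
    ⌊γ * r / 2⌋₊ + 2 - t ≤ resLinClauseSpace ϖ := by
  have hW := widthFromVertexExpansion_proof
  unfold Summit.PneNP.PneNP.Theses.ReslinSizeFromWidth.WidthFromVertexExpansion at hW
  refine resLinClauseSpace_of_rank hφ ht (fun π hπ => ?_) hϖ
  have h := hW γ r φ hγ hr hexp π hπ
  have hnn : 0 ≤ γ * r / 2 := by positivity
  have : (⌊γ * r / 2⌋₊ : ℝ) < resLinWidth π := (Nat.floor_le hnn).trans_lt h
  exact_mod_cast this

/-- **Random 3-CNFs need linear Res(⊕) clause space whp.** For every integer density `c ≥ 6`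
there is `δ > 0` with `Pr_{φ ∼ F₃(n, cn)}[φ unsatisfiable ∧ every configuration-style Res(⊕)
refutation ϖ of φ has δ·n < resLinClauseSpace ϖ] → 1`. From `randomThreeCnf_resLinRank_linear`
(rank `> δ₀ n` whp, gen-1 rung), clause width `3` inside the support, and the space–width relation
`resLinClauseSpace_of_rank` with `k = ⌊δ₀ n⌋`; `δ = δ₀ / 2`, for `n ≥ 8/δ₀`.
[GryaznovOvcharovRiazanov2024, Thm 6 and Cor 1; ChvatalSzemeredi1988; EfremenkoGarlikItsykson2024,
Thm 5.5] -/
theorem randomThreeCnf_resLinClauseSpace_linear (c : ℕ) (hc : 6 ≤ c) :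
    ∃ δ : ℝ, 0 < δ ∧ Tendsto (fun n : ℕ => (randomKCNF 3 n (c * n)).toOuterMeasure
      {φ | ¬ CNF.Satisfiable φ ∧ ∀ ϖ : List (Finset LinClause), IsResLinSpaceRefutation φ ϖ →
        δ * n < (resLinClauseSpace ϖ : ℝ)}) atTop (𝓝 1) := by
  obtain ⟨δ₀, hδ₀, hlim⟩ := randomThreeCnf_resLinRank_linear c hc
  refine ⟨δ₀ / 2, by positivity, ?_⟩
  -- width 3 inside the support
  have hwidth : ∀ {n m : ℕ} {φ : CNF ℕ}, φ ∈ (randomKCNF 3 n m).support → φ.IsWidthLE 3 := by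
    intro n m φ hφ cl hcl
    exact (length_of_mem_kClauses (forall_mem_of_mem_support_randomKCNF hφ cl hcl)).le
  -- eventually the rank event (within the support) lies inside the space event
  have hev : ∀ᶠ n : ℕ in atTop,
      (randomKCNF 3 n (c * n)).toOuterMeasure
          {φ | ¬ CNF.Satisfiable φ ∧ ∀ π : List ResLinLine, IsResLinRefutation φ π →
            δ₀ * n < (resLinWidth π : ℝ)} ≤
        (randomKCNF 3 n (c * n)).toOuterMeasure
          {φ | ¬ CNF.Satisfiable φ ∧ ∀ ϖ : List (Finset LinClause), IsResLinSpaceRefutation φ ϖ →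
            δ₀ / 2 * n < (resLinClauseSpace ϖ : ℝ)} := by
    refine eventually_atTop.2 ⟨⌈8 / δ₀⌉₊, fun n hn => ?_⟩
    have hn8 : 8 ≤ δ₀ * n := by
      have h1 : (⌈8 / δ₀⌉₊ : ℝ) ≤ n := by exact_mod_cast hn
      have h2 : 8 / δ₀ ≤ n := (Nat.le_ceil _).trans h1
      rw [div_le_iff₀ hδ₀] at h2
      linarith
    refine PMF.toOuterMeasure_mono _ ?_
    rintro φ ⟨⟨hns, hrank⟩, hsupp⟩
    refine ⟨hns, fun ϖ hϖ => ?_⟩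
    have hφ3 : φ.IsWidthLE 3 := hwidth hsupp
    -- `k = ⌊δ₀ n⌋` is below every rank-width
    set k : ℕ := ⌊δ₀ * n⌋₊ with hk
    have hkw : ∀ π', IsResLinRefutation φ π' → k < resLinWidth π' := by
      intro π' hπ'
      have h := hrank π' hπ'
      have : (⌊δ₀ * n⌋₊ : ℝ) < resLinWidth π' := (Nat.floor_le (by positivity)).trans_lt h
      exact_mod_cast this
    have hk3 : 3 ≤ k := Nat.le_floor (by push_cast; linarith)
    have hsp := resLinClauseSpace_of_rank hφ3 hk3 hkw hϖ
    -- real arithmetic: space ≥ k - 1 > δ₀ n - 2 ≥ δ₀ n / 2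
    have hkR : δ₀ * n < (k : ℝ) + 1 := by
      rw [hk]
      exact Nat.lt_floor_add_one _
    have hspR : ((k + 2 - 3 : ℕ) : ℝ) ≤ (resLinClauseSpace ϖ : ℝ) := by exact_mod_cast hsp
    have hsub : ((k + 2 - 3 : ℕ) : ℝ) = (k : ℝ) - 1 := by
      rw [show k + 2 - 3 = k - 1 by omega, Nat.cast_sub (by omega)]
      simp
    rw [hsub] at hspR
    linarith
  refine tendsto_of_tendsto_of_tendsto_of_le_of_le' hlim tendsto_const_nhds hev
    (Eventually.of_forall fun n => ?_)
  exact (MeasureTheory.measure_mono (Set.subset_univ _)).trans_eq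
    ((PMF.toOuterMeasure_apply_eq_one_iff _ _).2 (Set.subset_univ _))

/-- Every occurring variable below `n` bounds `numVars` by `n` (helper; cf. step (G0a) of the
route's `closes`). [folklore] -/
private theorem numVars_le_of_forall_lt {φ : CNF ℕ} {n : ℕ}
    (h : ∀ c ∈ φ, ∀ l ∈ c, l.1 < n) : φ.numVars ≤ n := by
  unfold CNF.numVars
  have key : ∀ L : List ℕ, (∀ v ∈ L, v ≤ n) → L.foldr max 0 ≤ n := by
    intro L
    induction L with
    | nil => intro _; simp
    | cons a L ih =>
      intro hL
      simp only [List.foldr_cons, max_le_iff]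
      exact ⟨hL a (by simp), ih fun v hv => hL v (by simp [hv])⟩
  refine key _ fun v hv => ?_
  obtain ⟨l, hl, rfl⟩ := List.mem_map.1 hv
  obtain ⟨c, hc, hlc⟩ := List.mem_flatten.1 hl
  exact h c hc l hlc

/-- **Matching upper bound on the support.** Every unsatisfiable formula in the support of the random
`k`-CNF ensemble `F_k(n, m)` (clauses over the variables `x₀, …, x_{n−1}`) has a configuration-style
Res(⊕) refutation of clause space `≤ n + 2` — so the lower bound of
`randomThreeCnf_resLinClauseSpace_linear` is tight up to the constant.
[EstebanToran2001, §3 (one system up: `minResLinClauseSpace_le_numVars_add_two`)] -/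
theorem minResLinClauseSpace_le_of_mem_support_randomKCNF {k n m : ℕ} {φ : CNF ℕ}
    (hφ : φ ∈ (randomKCNF k n m).support) (hns : ¬ CNF.Satisfiable φ) :
    minResLinClauseSpace φ ≤ (n + 2 : ℕ) := by
  have hcl := forall_mem_of_mem_support_randomKCNF hφ
  have hvars : φ.numVars ≤ n := by
    refine numVars_le_of_forall_lt fun c hc l hl => ?_
    have hsc : l.1 ∈ clauseScope c := mem_clauseScope.2 ⟨l.2, hl⟩
    exact Finset.mem_range.1 (clauseScope_subset_range (hcl c hc) hsc)
  refine (minResLinClauseSpace_le_numVars_add_two hns).trans ?_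
  exact_mod_cast Nat.add_le_add_right hvars 2

end Summit.PneNP.PneNP.Theorems
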